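import Literature.Barriers.RiemannHypothesis.GramRosserFailuresLehmanProofs
import HarnessLib

/-!
# The Gram sequence, and zeros of `ζ` on the critical line forced by sign patterns of `Z`

Sibling of `Literature/Barriers/RiemannHypothesis/GramRosserFailures.lean` (Gram points, Gram
blocks, Rosser's rule), `GramRosserFailuresProofs.lean` (Gram points exist and are unique) and
`GramRosserFailuresLehmanProofs.lean` (Lehman's argument from Selberg's theorem, whose bad-run
count `criticalZeroCount_add_le_of_bad_run` loses a bounded amount; Edwards' derivation of RH from
Rosser's rule needs the sharp count below).
Tools for Edwards' induction "Rosser's rule ⟹ `S(g_n) ≥ −1`" (*Riemann's Zeta Function*, §8.4;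
Trudgian, *Acta Arith.* 148 (2011), §7.3, (56)–(57)), all **proved**:

* `gramPt n` — *the* Gram point of index `n` (`ϑ(g_n) = nπ`, `g_n ≥ 10`), strictly increasing and
  unbounded (`gramPt_strictMono`, `tendsto_gramPt_atTop`, `IsGramPoint.eq_gramPt`).
* Zeros of `Z` raise `N₀ = Literature.NumberTheory.LFunctions.criticalZeroCount` (zeros of `ζ` on
  the line, with multiplicity): one zero in `(a, b]` (`criticalZeroCount_add_one_le_of_hardyZ_eq_zero`),
  a strict sign change (`…_of_mul_neg`), `k` strict sign changes in the sense of `HasSignChanges`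
  (`criticalZeroCount_add_le_of_hasSignChanges`), and a zero of multiplicity `m`
  (`criticalZeroCount_add_order_le`).
* The local structure of `Z` at one of its zeros `t₀` (`hardyZ_local_of_eq_zero`): either
  `½ + it₀` is a multiple zero of `ζ`, or `Z` changes sign strictly at `t₀` (from the factorisation
  `ζ(s) = (s − ρ) g(s)` at a simple zero and the reality of `e^{iϑ(t)} ζ(½ + it)`).
* **Weakly alternating signs force zeros counted with multiplicity**
  (`criticalZeroCount_add_le_of_weakAlternation`): if `(−1)^j σ Z(x_j) ≤ 0` at points
  `x_0 < ⋯ < x_d` (`σ = ±1`), then `N₀(x_d) ≥ N₀(t) + d` for every `0 ≤ t < x_0`. This is the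
  rigorous form of "if `g_m`, `g_{m+1}` are both bad, then `Z` changes sign on `[g_m, g_{m+1}]`, from
  which `S(g_{m+1}) ≥ S(g_m)`" (Edwards) / (57) of Trudgian, which as printed overlooks the case that
  `Z` vanishes *at* a bad Gram point: then the zero may already be counted at `g_m`, and it is the
  multiplicity (a zero of `Z` without sign change is a multiple zero of `ζ`) that restores the count.

## References

* [Edwards1974] H. M. Edwards, *Riemann's Zeta Function*, Academic Press 1974, §6.5, §8.3–8.4.
* [TrudgianGram2011] T. Trudgian, *On the success and failure of Gram's Law and the Rosser Rule*,
  Acta Arith. 148 (2011), §7.2–7.3.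
-/

noncomputable section

open Complex Filter Set Topology
open Literature.NumberTheory Literature.NumberTheory.LFunctions

namespace Literature.Barriers.RiemannHypothesis

/-! ## The Gram sequence -/

/-- **The Gram point of index `n`**: the unique `g ≥ 10` with `ϑ(g) = nπ`
(`Edwards1974_gramPoint_existsUnique_holds`). [cite: Edwards1974, §6.5] -/
def gramPt (n : ℕ) : ℝ :=
  Classical.choose (Edwards1974_gramPoint_existsUnique_holds n).exists

/-- `gramPt n` is a Gram point of index `n`. [cite: Edwards1974, §6.5] -/
theorem isGramPoint_gramPt (n : ℕ) : IsGramPoint n (gramPt n) :=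
  Classical.choose_spec (Edwards1974_gramPoint_existsUnique_holds n).exists

/-- Uniqueness: every Gram point of index `n` is `gramPt n`. [cite: Edwards1974, §6.5] -/
theorem IsGramPoint.eq_gramPt {n : ℕ} {g : ℝ} (h : IsGramPoint n g) : g = gramPt n :=
  (Edwards1974_gramPoint_existsUnique_holds n).unique h (isGramPoint_gramPt n)

/-- `gramPt n ≥ 10`. [cite: Edwards1974, §6.5] -/
theorem ten_le_gramPt (n : ℕ) : 10 ≤ gramPt n :=
  (isGramPoint_gramPt n).1

/-- `ϑ(gramPt n) = nπ`. [cite: Edwards1974, §6.5] -/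
theorem riemannSiegelTheta_gramPt (n : ℕ) : riemannSiegelTheta (gramPt n) = n * Real.pi :=
  (isGramPoint_gramPt n).2

/-- Gram points are ordered like their indices: `g < g'` iff `m < n` (`ϑ` is strictly increasing on
`[7, ∞)`). [cite: Edwards1974, §6.5] -/
theorem IsGramPoint.lt_iff_lt {m n : ℕ} {g g' : ℝ} (hg : IsGramPoint m g) (hg' : IsGramPoint n g') :
    g < g' ↔ m < n := by
  have h7 : (7 : ℝ) ≤ g := by linarith [hg.1]
  have h7' : (7 : ℝ) ≤ g' := by linarith [hg'.1]
  rw [← strictMonoOn_riemannSiegelTheta_Ici_seven.lt_iff_lt h7 h7', hg.2, hg'.2,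
    mul_lt_mul_iff_of_pos_right Real.pi_pos, Nat.cast_lt]

/-- Gram points are ordered like their indices (non-strict form). [cite: Edwards1974, §6.5] -/
theorem IsGramPoint.le_iff_le {m n : ℕ} {g g' : ℝ} (hg : IsGramPoint m g) (hg' : IsGramPoint n g') :
    g ≤ g' ↔ m ≤ n := by
  rw [← not_lt, hg'.lt_iff_lt hg, not_lt]

/-- The Gram sequence is strictly increasing. [cite: Edwards1974, §6.5] -/
theorem gramPt_strictMono : StrictMono gramPt := fun _ _ h ↦
  ((isGramPoint_gramPt _).lt_iff_lt (isGramPoint_gramPt _)).2 h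

/-- The Gram sequence is unbounded: `gramPt n → ∞`. [cite: Edwards1974, §6.5] -/
theorem tendsto_gramPt_atTop : Tendsto gramPt atTop atTop := by
  refine tendsto_atTop_atTop.2 fun b ↦ ?_
  -- `θ` is bounded on `[10, b]`; a Gram point beyond that bound has `g > b`
  obtain ⟨n, hn⟩ := exists_nat_gt (riemannSiegelTheta (max b 10) / Real.pi)
  refine ⟨n, fun m hm ↦ ?_⟩
  by_contra hlt
  push Not at hlt
  have h7 : (7 : ℝ) ≤ gramPt m := by linarith [ten_le_gramPt m]
  have hle : gramPt m ≤ max b 10 := hlt.le.trans (le_max_left _ _)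
  have hθ : riemannSiegelTheta (gramPt m) ≤ riemannSiegelTheta (max b 10) :=
    strictMonoOn_riemannSiegelTheta_Ici_seven.monotoneOn h7
      (show (7 : ℝ) ≤ max b 10 by linarith [le_max_right b 10]) hle
  rw [riemannSiegelTheta_gramPt] at hθ
  have hπ := Real.pi_pos
  have : (n : ℝ) ≤ m := by exact_mod_cast hm
  have h1 : (n : ℝ) * Real.pi ≤ riemannSiegelTheta (max b 10) := by nlinarith
  rw [div_lt_iff₀ hπ] at hn
  linarith

/-- Beyond every height there are only Gram points of large index: if `T ≤ gramPt n` fails for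
`n`, it fails for all smaller indices; precisely `gramPt n < T → ∀ m ≤ n, gramPt m < T`. [folklore] -/
theorem gramPt_lt_of_le {n m : ℕ} {T : ℝ} (h : gramPt n < T) (hm : m ≤ n) : gramPt m < T :=
  (gramPt_strictMono.monotone hm).trans_lt h

/-! ## Zeros of `Z` raise `N₀` -/

/-- A zero `c` of `Z` with `a < c ≤ b` (`0 ≤ a`) gives `N₀(a) + 1 ≤ N₀(b)`. [folklore] -/
theorem criticalZeroCount_add_one_le_of_hardyZ_eq_zero {a b c : ℝ} (ha : 0 ≤ a) (hac : a < c)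
    (hcb : c ≤ b) (hc : hardyZ c = 0) : criticalZeroCount a + 1 ≤ criticalZeroCount b := by
  have h := criticalZeroCount_add_card_le ha (hac.le.trans hcb) {c} fun γ hγ ↦ by
    rw [Finset.mem_singleton] at hγ
    subst hγ
    exact ⟨(hardyZ_eq_zero_iff_holds γ).1 hc, hac, hcb⟩
  rwa [Finset.card_singleton] at h

/-- A strict sign change of `Z` on `[a, b]` (`0 ≤ a < b`) gives `N₀(a) + 1 ≤ N₀(b)` (intermediate
value theorem; the zero lies in the open interval). [folklore] -/
theorem criticalZeroCount_add_one_le_of_mul_neg {a b : ℝ} (ha : 0 ≤ a) (hab : a < b)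
    (h : hardyZ a * hardyZ b < 0) : criticalZeroCount a + 1 ≤ criticalZeroCount b := by
  have h0 : (0 : ℝ) ∈ uIcc (hardyZ a) (hardyZ b) := by
    rcases mul_neg_iff.1 h with ⟨h1, h2⟩ | ⟨h1, h2⟩
    · exact mem_uIcc.2 (Or.inr ⟨h2.le, h1.le⟩)
    · exact mem_uIcc.2 (Or.inl ⟨h1.le, h2.le⟩)
  obtain ⟨c, hc, hfc⟩ := intermediate_value_uIcc continuous_hardyZ.continuousOn h0
  rw [uIcc_of_le hab.le] at hc
  have hne : c ≠ a := by
    rintro rfl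
    rw [hfc, zero_mul] at h
    exact lt_irrefl 0 h
  exact criticalZeroCount_add_one_le_of_hardyZ_eq_zero ha (lt_of_le_of_ne hc.1 hne.symm) hc.2 hfc

/-- **`k` strict sign changes of `Z` on `[a, b]` give `N₀(a) + k ≤ N₀(b)`** (`0 ≤ a`); this is how
Rosser's rule in Edwards' form feeds zeros into the count. [cite: Edwards1974, §8.3] -/
theorem criticalZeroCount_add_le_of_hasSignChanges {a b : ℝ} {k : ℕ} (ha : 0 ≤ a)
    (h : HasSignChanges hardyZ a b k) : criticalZeroCount a + k ≤ criticalZeroCount b := by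
  obtain ⟨t, ht, hmem, hsign⟩ := h
  -- along the sample points
  have key : ∀ i : ℕ, ∀ hi : i ≤ k,
      criticalZeroCount (t 0) + i ≤ criticalZeroCount (t ⟨i, Nat.lt_succ_of_le hi⟩) := by
    intro i
    induction i with
    | zero => intro _; simp
    | succ i ih =>
      intro hi
      have hi' : i < k := Nat.lt_of_succ_le hi
      have h1 := ih hi'.le
      have h0i : 0 ≤ t (Fin.castSucc ⟨i, hi'⟩) := (ha.trans (hmem 0).1).trans
        (ht.monotone (Fin.zero_le _))
      have hs := hsign ⟨i, hi'⟩
      have hlt : t (Fin.castSucc ⟨i, hi'⟩) < t (Fin.succ ⟨i, hi'⟩) := ht Fin.castSucc_lt_succ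
      have h2 := criticalZeroCount_add_one_le_of_mul_neg h0i hlt hs
      have e1 : (Fin.castSucc ⟨i, hi'⟩ : Fin (k + 1)) = ⟨i, Nat.lt_succ_of_lt hi'⟩ := rfl
      have e2 : (Fin.succ ⟨i, hi'⟩ : Fin (k + 1)) = ⟨i + 1, Nat.lt_succ_of_le hi⟩ := rfl
      rw [e1, e2] at h2
      omega
  have hk := key k le_rfl
  have hfirst : criticalZeroCount a ≤ criticalZeroCount (t 0) := criticalZeroCount_mono (hmem 0).1
  have hlast : criticalZeroCount (t ⟨k, Nat.lt_succ_of_le le_rfl⟩) ≤ criticalZeroCount b :=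
    criticalZeroCount_mono (hmem _).2
  omega

/-- **A zero of multiplicity `m` raises `N₀` by `m`**: if `ζ(½ + it₀) = 0` and `0 ≤ t < t₀`, then
`N₀(t) + m(½ + it₀) ≤ N₀(t₀)`. [folklore] -/
theorem criticalZeroCount_add_order_le {t t₀ : ℝ} (ht : 0 ≤ t) (htt₀ : t < t₀)
    (h0 : riemannZeta (1 / 2 + t₀ * I) = 0) :
    (criticalZeroCount t : ℤ) + riemannZetaZeroOrder (1 / 2 + t₀ * I) ≤ criticalZeroCount t₀ := by
  set ρ : ℂ := 1 / 2 + t₀ * I with hρ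
  set C : ℝ → Set ℂ := fun T ↦ {ρ ∈ zetaZeroBox (1 / 2) T | ρ.re = 1 / 2} with hC
  have hρre : ρ.re = 1 / 2 := by simp [hρ]
  have hρim : ρ.im = t₀ := by simp [hρ]
  have ht₀ : 0 < t₀ := ht.trans_lt htt₀
  have hρmem : ρ ∈ C t₀ := ⟨⟨h0, by rw [hρre], by rw [hρre]; norm_num, by rw [hρim]; exact ht₀,
    by rw [hρim]⟩, hρre⟩
  have hρnot : ρ ∉ C t := by
    rintro ⟨⟨-, -, -, -, h4⟩, -⟩
    rw [hρim] at h4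
    linarith
  have hsub : insert ρ (C t) ⊆ C t₀ := by
    rintro z (rfl | ⟨⟨hz0, hz1, hz2, hz3, hz4⟩, hz5⟩)
    · exact hρmem
    · exact ⟨⟨hz0, hz1, hz2, hz3, hz4.trans htt₀.le⟩, hz5⟩
  have hpos : ∀ z ∈ C t₀, 0 < riemannZetaZeroOrder z := fun z hz ↦
    DiophantineGeometry.riemannZetaZeroOrder_pos_of_mem_zetaZeroBox
      (DiophantineGeometry.criticalZeroSet_subset_zetaZeroBox t₀ hz)
  have hfin₀ : (C t₀).Finite := criticalZeroSet_finite t₀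
  have hfin : (C t).Finite := criticalZeroSet_finite t
  -- `Σ_{C t₀} ≥ Σ_{insert ρ (C t)} = m(ρ) + Σ_{C t}`
  have h1 : ∑ᶠ z ∈ insert ρ (C t), riemannZetaZeroOrder z =
      riemannZetaZeroOrder ρ + ∑ᶠ z ∈ C t, riemannZetaZeroOrder z :=
    finsum_mem_insert _ hρnot hfin
  have h2 : ∑ᶠ z ∈ insert ρ (C t), riemannZetaZeroOrder z ≤ ∑ᶠ z ∈ C t₀, riemannZetaZeroOrder z := by
    rw [finsum_mem_eq_finite_toFinset_sum _ (hfin.insert ρ), finsum_mem_eq_finite_toFinset_sum _ hfin₀]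
    refine Finset.sum_le_sum_of_subset_of_nonneg ?_ fun z hz _ ↦ (hpos z ?_).le
    · intro z hz
      rw [Set.Finite.mem_toFinset] at hz ⊢
      exact hsub hz
    · exact (Set.Finite.mem_toFinset _).1 hz
  have hnn : 0 ≤ ∑ᶠ z ∈ C t, riemannZetaZeroOrder z :=
    finsum_nonneg fun z ↦ finsum_nonneg fun hz ↦
      (DiophantineGeometry.riemannZetaZeroOrder_pos_of_mem_zetaZeroBox
        (DiophantineGeometry.criticalZeroSet_subset_zetaZeroBox t hz)).le
  have hnn₀ : 0 ≤ ∑ᶠ z ∈ C t₀, riemannZetaZeroOrder z :=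
    finsum_nonneg fun z ↦ finsum_nonneg fun hz ↦ (hpos z hz).le
  have e : (criticalZeroCount t : ℤ) = ∑ᶠ z ∈ C t, riemannZetaZeroOrder z := by
    unfold criticalZeroCount; rw [Int.toNat_of_nonneg hnn]
  have e₀ : (criticalZeroCount t₀ : ℤ) = ∑ᶠ z ∈ C t₀, riemannZetaZeroOrder z := by
    unfold criticalZeroCount; rw [Int.toNat_of_nonneg hnn₀]
  rw [e, e₀]
  linarith

/-! ## Local structure of `Z` at one of its zeros -/

/-- **`Z` at one of its zeros.** If `Z(t₀) = 0`, then either `ρ = ½ + it₀` is a zero of `ζ` of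
multiplicity at least `2`, or `Z` changes sign strictly at `t₀`: on some punctured neighbourhood
`Z < 0` to the left and `Z > 0` to the right, or the other way round. (At a simple zero,
`ζ(s) = (s − ρ) g(s)` with `g(ρ) ≠ 0`, so `e^{iϑ(t)} ζ(½ + it) = (t − t₀) w(t)` with
`w(t) = i e^{iϑ(t)} g(½ + it)` continuous and `w(t₀) ≠ 0`; since the left side is real
(`im_cexp_theta_mul_zeta_eq_zero`), `w` is real near `t₀` and `Z(t) = (t − t₀) Re w(t)`.)
[folklore] -/
theorem hardyZ_local_of_eq_zero {t₀ : ℝ} (h : hardyZ t₀ = 0) :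
    2 ≤ riemannZetaZeroOrder (1 / 2 + t₀ * I) ∨
    ∃ δ > 0, ((∀ t, t₀ - δ < t → t < t₀ → hardyZ t < 0) ∧ (∀ t, t₀ < t → t < t₀ + δ → 0 < hardyZ t)) ∨
      ((∀ t, t₀ - δ < t → t < t₀ → 0 < hardyZ t) ∧ (∀ t, t₀ < t → t < t₀ + δ → hardyZ t < 0)) := by
  set L : ℝ → ℂ := fun t ↦ 1 / 2 + t * I with hL
  have hLc : Continuous L := by rw [hL]; fun_prop
  have hρ1 : L t₀ ≠ 1 := by
    intro h1
    have := congrArg Complex.re h1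
    norm_num [hL] at this
  have hζ : riemannZeta (L t₀) = 0 := (hardyZ_eq_zero_iff_holds t₀).1 h
  have ha : AnalyticAt ℂ riemannZeta (L t₀) := analyticOn_riemannZeta (L t₀) hρ1
  -- the order of the zero is a positive natural number `n`
  have hne : analyticOrderAt riemannZeta (L t₀) ≠ ⊤ := by
    intro htop
    have h2 : riemannZeta 2 = 0 :=
      analyticOn_riemannZeta.eqOn_zero_of_preconnected_of_eventuallyEq_zero
        (isConnected_compl_singleton_of_one_lt_rank (by simp) (1 : ℂ)).isPreconnected hρ1
        (analyticOrderAt_eq_top.mp htop) (show (2 : ℂ) ∈ ({1}ᶜ : Set ℂ) by norm_num)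
    exact riemannZeta_ne_zero_of_one_le_re (s := 2) (by norm_num) h2
  obtain ⟨n, hn⟩ := ENat.ne_top_iff_exists.mp hne
  have hn0 : n ≠ 0 := by
    rintro rfl
    exact (ha.analyticOrderAt_eq_zero.1 hn.symm) hζ
  have hord : riemannZetaZeroOrder (L t₀) = n := by
    rw [riemannZetaZeroOrder, ha.meromorphicOrderAt_eq, ← hn, ENat.map_coe, WithTop.untop₀_coe]
  by_cases h2 : 2 ≤ n
  · left
    rw [hord]
    exact_mod_cast h2
  right
  have hn1 : n = 1 := by omega
  subst hn1
  -- factorisation at the simple zero: `ζ(z) = (z - ρ) g(z)` near `ρ = L t₀`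
  obtain ⟨g, hg, hg0, hfac⟩ := ha.analyticOrderAt_eq_natCast.1 hn.symm
  have hLt : Tendsto L (𝓝 t₀) (𝓝 (L t₀)) := hLc.tendsto t₀
  have hfacR : ∀ᶠ t : ℝ in 𝓝 t₀, riemannZeta (L t) = ((t - t₀ : ℝ) : ℂ) * I * g (L t) := by
    filter_upwards [hLt.eventually hfac] with t ht
    rw [ht, pow_one, smul_eq_mul]
    simp only [hL]
    push_cast
    ring
  -- `w(t) = i e^{iθ(t)} g(L t)`, continuous at `t₀`, with `Z(t) = (t - t₀) w(t)` near `t₀`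
  set w : ℝ → ℂ := fun t ↦ I * cexp (riemannSiegelTheta t * I) * g (L t) with hw
  have hwc : ContinuousAt w t₀ := by
    have h1 : ContinuousAt (fun t : ℝ ↦ cexp (riemannSiegelTheta t * I)) t₀ :=
      (Complex.continuous_exp.comp ((Complex.continuous_ofReal.comp
        continuous_riemannSiegelTheta).mul continuous_const)).continuousAt
    have h2 : ContinuousAt (fun t : ℝ ↦ g (L t)) t₀ :=
      ContinuousAt.comp (f := L) hg.continuousAt hLc.continuousAt
    exact (continuousAt_const.mul h1).mul h2
  have hZw : ∀ᶠ t : ℝ in 𝓝 t₀, (hardyZ t : ℂ) = ((t - t₀ : ℝ) : ℂ) * w t := by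
    filter_upwards [hfacR] with t ht
    rw [ofReal_hardyZ_holds t, show (1 : ℂ) / 2 + t * I = L t from rfl, ht, hw]
    ring
  have hre : ∀ᶠ t : ℝ in 𝓝 t₀, hardyZ t = (t - t₀) * (w t).re := by
    filter_upwards [hZw] with t ht
    have := congrArg Complex.re ht
    rwa [Complex.ofReal_re, Complex.re_ofReal_mul] at this
  have him : ∀ᶠ t : ℝ in 𝓝 t₀, (t - t₀) * (w t).im = 0 := by
    filter_upwards [hZw] with t ht
    have := congrArg Complex.im ht
    rw [Complex.ofReal_im, Complex.im_ofReal_mul] at this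
    exact this.symm
  -- `w(t₀)` is real and non-zero
  have hw0 : w t₀ ≠ 0 := by
    simp only [hw]
    exact mul_ne_zero (mul_ne_zero I_ne_zero (Complex.exp_ne_zero _)) hg0
  have hwim : (w t₀).im = 0 := by
    have h1 : ∀ᶠ t : ℝ in 𝓝[≠] t₀, (w t).im = 0 := by
      have h' : ∀ᶠ t : ℝ in 𝓝[≠] t₀, t ≠ t₀ := eventually_mem_nhdsWithin
      filter_upwards [him.filter_mono nhdsWithin_le_nhds, h'] with t ht hne
      exact (mul_eq_zero.1 ht).resolve_left (sub_ne_zero.2 hne)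
    have hlim : Tendsto (fun t ↦ (w t).im) (𝓝[≠] t₀) (𝓝 (w t₀).im) :=
      ((Complex.continuous_im.continuousAt.comp hwc).tendsto).mono_left nhdsWithin_le_nhds
    have hlim0 : Tendsto (fun t ↦ (w t).im) (𝓝[≠] t₀) (𝓝 0) :=
      tendsto_const_nhds.congr' (h1.mono fun t ht ↦ ht.symm)
    exact tendsto_nhds_unique hlim hlim0
  have hwre : (w t₀).re ≠ 0 := by
    intro h0
    exact hw0 (Complex.ext h0 hwim)
  have hrec : ContinuousAt (fun t ↦ (w t).re) t₀ := Complex.continuous_re.continuousAt.comp hwc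
  -- the sign of `Re w` near `t₀` decides the direction of the sign change
  rcases lt_or_gt_of_ne hwre with hneg | hpos
  · -- `Re w(t₀) < 0`: `Z > 0` on the left, `Z < 0` on the right
    have hev : ∀ᶠ t : ℝ in 𝓝 t₀, hardyZ t = (t - t₀) * (w t).re ∧ (w t).re < 0 :=
      hre.and (hrec.eventually (gt_mem_nhds hneg))
    obtain ⟨δ, hδ, hball⟩ := Metric.eventually_nhds_iff.1 hev
    refine ⟨δ, hδ, Or.inr ⟨fun t h1 h2 ↦ ?_, fun t h1 h2 ↦ ?_⟩⟩
    · obtain ⟨e, hlt⟩ := hball (show dist t t₀ < δ by rw [Real.dist_eq, abs_lt]; constructor <;> linarith)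
      rw [e]
      exact mul_pos_of_neg_of_neg (by linarith) hlt
    · obtain ⟨e, hlt⟩ := hball (show dist t t₀ < δ by rw [Real.dist_eq, abs_lt]; constructor <;> linarith)
      rw [e]
      exact mul_neg_of_pos_of_neg (by linarith) hlt
  · -- `Re w(t₀) > 0`: `Z < 0` on the left, `Z > 0` on the right
    have hev : ∀ᶠ t : ℝ in 𝓝 t₀, hardyZ t = (t - t₀) * (w t).re ∧ 0 < (w t).re :=
      hre.and (hrec.eventually (lt_mem_nhds hpos))
    obtain ⟨δ, hδ, hball⟩ := Metric.eventually_nhds_iff.1 hev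
    refine ⟨δ, hδ, Or.inl ⟨fun t h1 h2 ↦ ?_, fun t h1 h2 ↦ ?_⟩⟩
    · obtain ⟨e, hlt⟩ := hball (show dist t t₀ < δ by rw [Real.dist_eq, abs_lt]; constructor <;> linarith)
      rw [e]
      exact mul_neg_of_neg_of_pos (by linarith) hlt
    · obtain ⟨e, hlt⟩ := hball (show dist t t₀ < δ by rw [Real.dist_eq, abs_lt]; constructor <;> linarith)
      rw [e]
      exact mul_pos (by linarith) hlt

/-- **A zero of `Z` without sign change is a multiple zero**, in the form used below: if
`Z(t₀) = 0` and `½ + it₀` is a simple zero of `ζ` in the weak sense `m(½ + it₀) < 2`, then `Z` takes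
both signs in every punctured neighbourhood — packaged as the sign-change alternative of
`hardyZ_local_of_eq_zero`. [folklore] -/
theorem hardyZ_sign_change_of_order_lt_two {t₀ : ℝ} (h : hardyZ t₀ = 0)
    (hord : riemannZetaZeroOrder (1 / 2 + t₀ * I) < 2) :
    ∃ δ > 0, ((∀ t, t₀ - δ < t → t < t₀ → hardyZ t < 0) ∧ (∀ t, t₀ < t → t < t₀ + δ → 0 < hardyZ t)) ∨
      ((∀ t, t₀ - δ < t → t < t₀ → 0 < hardyZ t) ∧ (∀ t, t₀ < t → t < t₀ + δ → hardyZ t < 0)) :=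
  (hardyZ_local_of_eq_zero h).resolve_left (not_le.2 hord)

/-! ## Weakly alternating signs force zeros, counted with multiplicity -/

/-- Consecutive increase gives increase: `x i < x (i+1)` for `i < n` implies `x i < x j` for
`i < j ≤ n`. [folklore] -/
theorem lt_of_forall_lt_succ {x : ℕ → ℝ} {n : ℕ} (hx : ∀ i, i < n → x i < x (i + 1)) :
    ∀ {i j : ℕ}, i < j → j ≤ n → x i < x j := by
  intro i j hij hjn
  induction j with
  | zero => exact absurd hij (Nat.not_lt_zero _)
  | succ j ih =>
    rcases Nat.lt_succ_iff_lt_or_eq.1 hij with h | rfl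
    · exact (ih h (Nat.le_of_succ_le hjn)).trans (hx j (Nat.lt_of_succ_le hjn))
    · exact hx _ (Nat.lt_of_succ_le hjn)

/-- `((−1)^j σ)² = 1` for `σ = ±1`. [folklore] -/
theorem neg_one_pow_mul_sq {σ : ℝ} (hσ : σ = 1 ∨ σ = -1) (j : ℕ) :
    ((-1 : ℝ) ^ j * σ) ^ 2 = 1 := by
  rcases neg_one_pow_eq_or ℝ j with h | h <;> rcases hσ with h' | h' <;> simp [h, h']

/-- `(−1)^{j+1} σ = −((−1)^j σ)`. [folklore] -/
theorem neg_one_pow_succ_mul (σ : ℝ) (j : ℕ) :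
    (-1 : ℝ) ^ (j + 1) * σ = -((-1 : ℝ) ^ j * σ) := by
  rw [pow_succ]; ring

/-- If `κ² = 1`, `κ a < 0` and `κ b > 0`, then `a b < 0`. [folklore] -/
theorem mul_neg_of_sq_eq_one {κ a b : ℝ} (hκ : κ ^ 2 = 1) (ha : κ * a < 0) (hb : 0 < κ * b) :
    a * b < 0 := by
  have e : a * b = κ * a * (κ * b) := by linear_combination (-(a * b)) * hκ
  rw [e]
  exact mul_neg_of_neg_of_pos ha hb

/-- If `κ² = 1`, `κ z ≤ 0` and `z ≠ 0`, then `κ z < 0`. [folklore] -/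
theorem mul_neg_of_le_of_ne {κ z : ℝ} (hκ : κ ^ 2 = 1) (hle : κ * z ≤ 0) (hz : z ≠ 0) :
    κ * z < 0 := by
  refine lt_of_le_of_ne hle (mul_ne_zero ?_ hz)
  rintro rfl
  norm_num at hκ

/-- **Weak alternation forces zeros (with multiplicity).** Let `x_0 < x_1 < ⋯ < x_d` and
`σ = ±1` with `(−1)^j σ Z(x_j) ≤ 0` for all `j ≤ d` (the signs of `Z` alternate *weakly* along the
nodes). Then for every `0 ≤ t < x_0`, `N₀(t) + d ≤ N₀(x_d)`: the zeros of `ζ` on the critical line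
with ordinates in `(t, x_d]`, counted with multiplicity, number at least `d`. (Strict alternation
would give `d` sign changes and `d` distinct zeros in `(x_0, x_d)`; a node at which `Z` vanishes is
either itself a zero in the count, or — if the count would otherwise fall short — a zero at which
`Z` does not change sign, hence a multiple zero of `ζ`, `hardyZ_local_of_eq_zero`.) Applied to a
run of consecutive bad Gram points this is the rigorous form of Edwards' "if `g_m`, `g_{m+1}` are
both bad, then `Z` changes sign on `[g_m, g_{m+1}]`, from which `S(g_{m+1}) ≥ S(g_m)`".
[cite: Edwards1974, §8.4] -/
theorem criticalZeroCount_add_le_of_weakAlternation :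
    ∀ (d : ℕ) (x : ℕ → ℝ) (σ : ℝ), (σ = 1 ∨ σ = -1) → (∀ i, i < d → x i < x (i + 1)) →
      (∀ j, j ≤ d → (-1 : ℝ) ^ j * σ * hardyZ (x j) ≤ 0) →
      ∀ t : ℝ, 0 ≤ t → t < x 0 → criticalZeroCount t + d ≤ criticalZeroCount (x d) := by
  intro d
  induction d using Nat.strong_induction_on with
  | _ d ih =>
  intro x σ hσ hx halt t ht htx
  rcases d with _ | d
  · simpa using criticalZeroCount_mono htx.le
  -- nodes `x 0 < ⋯ < x (d+1)`; all of them exceed `t ≥ 0`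
  have hmono : ∀ {i j : ℕ}, i < j → j ≤ d + 1 → x i < x j := lt_of_forall_lt_succ hx
  have hpos : ∀ j, j ≤ d + 1 → 0 ≤ x j := by
    intro j hj
    rcases Nat.eq_zero_or_pos j with rfl | hj0
    · exact ht.trans htx.le
    · exact (ht.trans htx.le).trans (hmono hj0 hj).le
  have hsq := neg_one_pow_mul_sq hσ
  -- the prefix `x 0, …, x d` (induction hypothesis at `d`)
  have hprefix : criticalZeroCount t + d ≤ criticalZeroCount (x d) :=
    ih d (Nat.lt_succ_self d) x σ hσ (fun i hi ↦ hx i (Nat.lt_succ_of_lt hi))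
      (fun j hj ↦ halt j (Nat.le_succ_of_le hj)) t ht htx
  have hlast : x d < x (d + 1) := hx d (Nat.lt_succ_self d)
  by_cases hZ1 : hardyZ (x (d + 1)) = 0
  · -- the last node is itself a zero in `(x d, x (d+1)]`
    have h1 := criticalZeroCount_add_one_le_of_hardyZ_eq_zero (hpos d (Nat.le_succ d)) hlast le_rfl hZ1
    omega
  -- the last node carries a strict sign
  have hs1 : (-1 : ℝ) ^ (d + 1) * σ * hardyZ (x (d + 1)) < 0 :=
    mul_neg_of_le_of_ne (hsq (d + 1)) (halt (d + 1) le_rfl) hZ1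
  have hs1' : 0 < (-1 : ℝ) ^ d * σ * hardyZ (x (d + 1)) := by
    rw [neg_one_pow_succ_mul] at hs1; linarith
  by_cases hZ0 : hardyZ (x d) = 0
  swap
  · -- strict sign change between `x d` and `x (d+1)`
    have hs0 : (-1 : ℝ) ^ d * σ * hardyZ (x d) < 0 :=
      mul_neg_of_le_of_ne (hsq d) (halt d (Nat.le_succ d)) hZ0
    have hprod : hardyZ (x d) * hardyZ (x (d + 1)) < 0 := mul_neg_of_sq_eq_one (hsq d) hs0 hs1'
    have h1 := criticalZeroCount_add_one_le_of_mul_neg (hpos d (Nat.le_succ d)) hlast hprod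
    omega
  -- `Z` vanishes at the node `x d`
  rcases d with _ | d
  · -- `x 0` is a zero in `(t, x 1]`
    have h1 := criticalZeroCount_add_one_le_of_hardyZ_eq_zero ht htx hlast.le hZ0
    simpa using h1
  -- nodes `x 0, …, x d, x (d+1)` (the zero), `x (d+2)`; prefix up to `x d` by induction at `d`
  have hprefix' : criticalZeroCount t + d ≤ criticalZeroCount (x d) :=
    ih d (by omega) x σ hσ (fun i hi ↦ hx i (by omega)) (fun j hj ↦ halt j (by omega)) t ht htx
  have hdd1 : x d < x (d + 1) := hx d (by omega)
  rcases hardyZ_local_of_eq_zero hZ0 with hord | ⟨δ, hδ, hsc⟩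
  · -- a multiple zero at `x (d+1)`: it counts twice
    have hζ : riemannZeta (1 / 2 + x (d + 1) * I) = 0 := (hardyZ_eq_zero_iff_holds _).1 hZ0
    have h2 := criticalZeroCount_add_order_le (hpos d (by omega)) hdd1 hζ
    have h3 : criticalZeroCount (x (d + 1)) ≤ criticalZeroCount (x (d + 1 + 1)) :=
      criticalZeroCount_mono hlast.le
    have h2' : (criticalZeroCount (x d) : ℤ) + 2 ≤ criticalZeroCount (x (d + 1)) := by linarith
    have h2'' : criticalZeroCount (x d) + 2 ≤ criticalZeroCount (x (d + 1)) := by exact_mod_cast h2'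
    omega
  -- a simple zero at `x (d+1)`: `Z` changes sign there; `κ = (−1)^{d+1} σ` is the sign to beat
  set κ : ℝ := (-1 : ℝ) ^ (d + 1) * σ with hκdef
  have hκ : κ = 1 ∨ κ = -1 := by
    rcases neg_one_pow_eq_or ℝ (d + 1) with h | h <;> rcases hσ with h' | h' <;> simp [hκdef, h, h']
  have hκsq : κ ^ 2 = 1 := hsq (d + 1)
  -- on one side of `x (d+1)`, `κ Z < 0`
  have hside : (∀ u, x (d + 1) < u → u < x (d + 1) + δ → κ * hardyZ u < 0) ∨
      (∀ u, x (d + 1) - δ < u → u < x (d + 1) → κ * hardyZ u < 0) := by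
    rcases hsc with ⟨hl, hr⟩ | ⟨hl, hr⟩ <;> rcases hκ with hk | hk
    · right; intro u h1 h2; rw [hk, one_mul]; exact hl u h1 h2
    · left; intro u h1 h2; rw [hk, neg_one_mul, neg_lt_zero]; exact hr u h1 h2
    · left; intro u h1 h2; rw [hk, one_mul]; exact hr u h1 h2
    · right; intro u h1 h2; rw [hk, neg_one_mul, neg_lt_zero]; exact hl u h1 h2
  rcases hside with hright | hleft
  · -- perturb to the right: `x' ∈ (x (d+1), x (d+2))` close to `x (d+1)` with `κ Z(x') < 0`
    set x' : ℝ := x (d + 1) + min (δ / 2) ((x (d + 1 + 1) - x (d + 1)) / 2) with hx'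
    have hm1 : min (δ / 2) ((x (d + 1 + 1) - x (d + 1)) / 2) ≤ δ / 2 := min_le_left _ _
    have hm2 : min (δ / 2) ((x (d + 1 + 1) - x (d + 1)) / 2) ≤ (x (d + 1 + 1) - x (d + 1)) / 2 :=
      min_le_right _ _
    have hm0 : 0 < min (δ / 2) ((x (d + 1 + 1) - x (d + 1)) / 2) := lt_min (by linarith) (by linarith)
    have h1 : x (d + 1) < x' := by rw [hx']; linarith
    have h2 : x' < x (d + 1) + δ := by rw [hx']; linarith
    have h3 : x' < x (d + 1 + 1) := by rw [hx']; linarith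
    have hneg : κ * hardyZ x' < 0 := hright x' h1 h2
    have hprod : hardyZ x' * hardyZ (x (d + 1 + 1)) < 0 := mul_neg_of_sq_eq_one hκsq hneg hs1'
    have h4 := criticalZeroCount_add_one_le_of_mul_neg ((hpos (d + 1) (by omega)).trans h1.le) h3 hprod
    have h5 : criticalZeroCount (x (d + 1)) ≤ criticalZeroCount x' := criticalZeroCount_mono h1.le
    omega
  · -- perturb to the left: replace the node `x (d+1)` by `x' ∈ (x d, x (d+1))` with `κ Z(x') < 0`
    set x' : ℝ := x (d + 1) - min (δ / 2) ((x (d + 1) - x d) / 2) with hx'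
    have hm1 : min (δ / 2) ((x (d + 1) - x d) / 2) ≤ δ / 2 := min_le_left _ _
    have hm2 : min (δ / 2) ((x (d + 1) - x d) / 2) ≤ (x (d + 1) - x d) / 2 := min_le_right _ _
    have hm0 : 0 < min (δ / 2) ((x (d + 1) - x d) / 2) := lt_min (by linarith) (by linarith)
    have h1 : x' < x (d + 1) := by rw [hx']; linarith
    have h2 : x (d + 1) - δ < x' := by rw [hx']; linarith
    have h3 : x d < x' := by rw [hx']; linarith
    have hneg : κ * hardyZ x' < 0 := hleft x' h2 h1
    set y : ℕ → ℝ := Function.update x (d + 1) x' with hy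
    have hy_of_ne : ∀ i, i ≠ d + 1 → y i = x i := fun i hi ↦ by
      rw [hy, Function.update_of_ne hi]
    have hy_eq : y (d + 1) = x' := by rw [hy, Function.update_self]
    have hyx : ∀ i, i < d + 1 → y i < y (i + 1) := by
      intro i hi
      rw [hy_of_ne i hi.ne]
      rcases Nat.lt_succ_iff_lt_or_eq.1 hi with h | rfl
      · rw [hy_of_ne (i + 1) (by omega)]; exact hx i (by omega)
      · rw [hy_eq]; exact h3
    have hyalt : ∀ j, j ≤ d + 1 → (-1 : ℝ) ^ j * σ * hardyZ (y j) ≤ 0 := by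
      intro j hj
      rcases Nat.lt_or_eq_of_le hj with h | rfl
      · rw [hy_of_ne j h.ne]; exact halt j (by omega)
      · rw [hy_eq]; exact hneg.le
    have hy0 : t < y 0 := by rw [hy_of_ne 0 (by omega)]; exact htx
    have h4 := ih (d + 1) (by omega) y σ hσ hyx hyalt t ht hy0
    rw [hy_eq] at h4
    -- the zero `x (d+1)` lies in `(x', x (d+2)]`
    have h5 := criticalZeroCount_add_one_le_of_hardyZ_eq_zero
      ((hpos d (by omega)).trans h3.le) h1 hlast.le hZ0
    omega

end Literature.Barriers.RiemannHypothesis
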